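import Summits.ABC.IUTFork.Conditional.WRowFrey37569208117GapFifteen
import HarnessLib

/-!
# R-W WINDOW-TABLE «W:GAP-1019» completion — the REFUTED side of the gap below the band: `7¹¹·19 + 5¹²·1019·7151² = 2²⁸·3¹²·11³·67`.
# (A) At every prime `139 ≤ l ≤ 1655` the licence FAILS on the untwisted sub-class `e(·|7) ∣ 15·l`; at every prime `487 ≤ l ≤ 811` it FAILS
# for EVERY genuine datum (both local types at `7` fail) — uniformly in `l`, floor-free certificates

PROOF-ONLY file (D-0012; 0 definitions, 0 `Prop` facts, no instance) of the abc-iut cell — D-0079 RESCUE sub-cell R-W «WINDOW Θ-SIDE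
INEQUALITY», seat abc-iut-w5-d009 (gen 14), row «W:GAP-1019» (TYPE-SPLIT class; abc-iut-plan C-R83 / C-R87 (c) / C-R89). It lifts this seat's
fixed-level half (A) `WRowFrey37569208117GapFifteen` (`l = 1019`, p494058) to bands, over this seat's negative pinned-type triple socket
`WRow.not_licence_triple_of_not_hullCell` (`Cor312LicenceTripleHullCellRefute`, p493429) and the local-type dichotomy
`WRow.localType_seven_frey37569208117` (`e(K_x/ℚ₇) ∈ {15·l, 30·l}`). The failing packet is always `(p, j) = (7, l⋆)`; the floor of the hull column
`HullCell` is removed one-sidedly (`e·⌊x/e⌋ > x − e`), leaving quadratic certificates in `k = (l−1)/2`: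
* untwisted type `e = 15·l`, turning point `a₀ = 4` (`139 ≤ l ≤ 959`): `0 ≤ 10k² + 2169k + 2158` (always); `a₀ = 5` (`961 ≤ l ≤ 1655`):
  `20k² − 16530k − 16549 ≤ 0` iff `k ≤ 827` (the one remaining gap prime `1657` keeps the floor: decided at `e = 15·l` by the exact cell, margin
  `14038`, not filed here; from `1663` on BOTH types pass — `WRowFrey37569208117AllLevels`);
* twisted type `e = 30·l`, `a₀ = 5` (`481 ≤ l ≤ 815`): `40k² − 16252k − 16291 ≤ 0` iff `k ≤ 407`; from `l = 821` on the twisted type PASSES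
  (`WRowFrey37569208117GapThirtyBand`).
TAKES NO SIDE on [IUTchIII] Cor. 3.12 (S. Mochizuki, *Inter-universal Teichmüller theory III*, Cor. 3.12 p. 173–174; Step (xi-f) p. 184) or on any
author; «refuted as typed» ≠ «refuted in print».

WHAT IS PROVED (namespace `Summit.ABC.IUTFork.Conditional`): §1 `WRow.not_hullCell_frey37569208117_fifteen_band4` / `_band5` / `WRow.not_hullCell_frey37569208117_thirty_band`
(the certificates); §2 **`WRow.not_licence_frey37569208117_gap_of_fifteen`** — every prime `139 ≤ l ≤ 1655`, every genuine Θ-volume datum over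
`(ratPoint (7¹¹·19/c), l)` whose places over `7` have `e(K_x/ℚ₇) ∣ 15·l`, every pair of realising ideles: `¬ Thm311ToCor312.Licence (settingPrVolSharp
(pilotDataOfK T.D T.K) …)`; §3 **`WRow.not_licence_frey37569208117_gap_low`** — every prime `487 ≤ l ≤ 811`, EVERY genuine datum (NO local-type
hypothesis), every pair of realising ideles: `¬ Licence`; **`GenuineK.not_pilotKummerCompatHull_chosen_frey37569208117_gap_low`** — the same in the
instance shape of the W-lane refutations (chosen ideles, pinned reading). READING (neutral): with the [LIN] band (`15 ≤ l ≤ 480`, abc-iut-w5-d107)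
and this seat's files the triple's l-axis reads: REFUTED ∀T at every prime `15 ≤ l ≤ 811`; TYPE-SPLIT («REF @ e₇ = 15·l · INH @ e₇ = 30·l») at every
prime `821 ≤ l ≤ 1637` and at `1657` on the twisted side (the untwisted side of `1657` is desk-only); INHABITED ∀T at every prime `l ≥ 1663`. Only
`{17,…,127, 1019, 7151}` are Szpiro-bad (abc-iut-W-num-5). Admissibility / (P6) / NON-EMPTINESS of the datum types are NOT claimed. HONEST SCOPE: OUR
sharp containers; STRONGER-THAN-PRINT hull reading; nothing about the printed inequality or any author's intended hull; typed ≠ proved; no abc claim.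
[cite: Mochizuki2012, IUTchI Def. 3.1 (b),(c) pp. 61–62, Ex. 3.2 (iv) p. 71; IUTchIII Cor. 3.12 Step (xi-f) p. 184; IUTchIV Prop. 1.1 p. 9, Prop. 1.2 (i)(ii) p. 10, Cor. 2.2 (ii) proof (P5) p. 46]
[cite: DupuyHilado2025, §3.4, §4.9, §4.12] [cite: SerreLocalFields1979, Ch. III §6 Prop. 13] [cite: SilvermanATAEC1994, V.5 Thm. 5.3 and Cor. 5.4]
[claim: Mochizuki2012, status: disputed] for every IUT sentence.
-/

noncomputable section

open Set Function Metric NumberField IsDedekindDomain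

namespace Summit.ABC.IUTFork.Conditional

open Thm311 Thm311.Real Cor312 Cor312Vol Cor312Prov Literature.IUT.LogThetaLattice Literature.IUT.LogVolume
  Literature.IUT.HodgeTheaters Literature.IUT.LogVolume.Cor22 Literature.IUT.LogVolume.ThetaData
open Literature.NumberTheory.NumberFields Literature.NumberTheory.GaloisRepresentations.Ultrametric
open Literature.NumberTheory.DiophantineGeometry Literature.NumberTheory.DiophantineGeometry.GenEll
open Summit.ABC.IUTFork.Repair.RH.HullThresholdExact Summit.ABC.IUTFork.Repair.RH.HullThresholdExactRefute

/-! ## §1. Floor-free certificates: the hull column FAILS at `(7, l⋆)` -/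

/-- The floor of R-H row 4's column removed one-sidedly: `e·⌊x/e⌋ > x − e`, so `m − (j+1)·r_out + e ≤ x` refutes `HullCell e m j r_in r_out`
(`x = j²m − j(e−1) − (j+1)·r_in`). [folklore] -/
private theorem not_hullCell_of_le {e m j rin rout : ℤ} (he : 0 < e)
    (hle : m - (j + 1) * rout + e ≤ j ^ 2 * m - j * (e - 1) - (j + 1) * rin) : ¬ HullCell e m j rin rout := by
  intro h
  unfold HullCell at h
  have h1 := Int.emod_def (j ^ 2 * m - j * (e - 1) - (j + 1) * rin) e
  have h2 := Int.emod_lt_of_pos (j ^ 2 * m - j * (e - 1) - (j + 1) * rin) he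
  linarith

/-- **Untwisted type `e = 15·l`, turning point `4` (`l = 2k+1`, `69 ≤ k ≤ 479`)**: the column fails at the top label (`0 ≤ 10k² + 2169k + 2158`). [folklore] -/
theorem WRow.not_hullCell_frey37569208117_fifteen_band4 (k : ℕ) (h1 : 69 ≤ k) (h2 : k ≤ 479) :
    ¬ HullCell ((15 * (2 * k + 1) : ℕ) : ℤ) ((165 : ℕ) : ℤ) (((k - 1 : ℕ) : ℤ) + 1) ((15 * (2 * k + 1) / (7 - 1) + 1 : ℕ) : ℤ)
      (((7 : ℕ) : ℤ) ^ 4 - ((4 : ℕ) : ℤ) * ((15 * (2 * k + 1) : ℕ) : ℤ)) := by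
  have hq : 15 * (2 * k + 1) / (7 - 1) = 5 * k + 2 := by omega
  have hk : (((k - 1 : ℕ) : ℤ) + 1) = (k : ℤ) := by rw [Nat.cast_sub (by omega : 1 ≤ k)]; push_cast; ring
  rw [hq, hk]
  refine not_hullCell_of_le (by positivity) ?_
  have hk0 : (69 : ℤ) ≤ (k : ℤ) := by exact_mod_cast h1
  push_cast
  nlinarith

/-- **Untwisted type `e = 15·l`, turning point `5` (`l = 2k+1`, `480 ≤ k ≤ 827`)**: the column fails at the top label (`20k² − 16530k − 16549 ≤ 0`). [folklore] -/
theorem WRow.not_hullCell_frey37569208117_fifteen_band5 (k : ℕ) (h1 : 480 ≤ k) (h2 : k ≤ 827) :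
    ¬ HullCell ((15 * (2 * k + 1) : ℕ) : ℤ) ((165 : ℕ) : ℤ) (((k - 1 : ℕ) : ℤ) + 1) ((15 * (2 * k + 1) / (7 - 1) + 1 : ℕ) : ℤ)
      (((7 : ℕ) : ℤ) ^ 5 - ((5 : ℕ) : ℤ) * ((15 * (2 * k + 1) : ℕ) : ℤ)) := by
  have hq : 15 * (2 * k + 1) / (7 - 1) = 5 * k + 2 := by omega
  have hk : (((k - 1 : ℕ) : ℤ) + 1) = (k : ℤ) := by rw [Nat.cast_sub (by omega : 1 ≤ k)]; push_cast; ring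
  rw [hq, hk]
  refine not_hullCell_of_le (by positivity) ?_
  have hk0 : (480 : ℤ) ≤ (k : ℤ) := by exact_mod_cast h1
  have hk1 : (k : ℤ) ≤ 827 := by exact_mod_cast h2
  push_cast
  nlinarith [mul_nonneg (sub_nonneg.2 hk0) (sub_nonneg.2 hk1)]

/-- **Twisted type `e = 30·l`, turning point `5` (`l = 2k+1`, `240 ≤ k ≤ 407`)**: the column fails at the top label (`40k² − 16252k − 16291 ≤ 0`). [folklore] -/
theorem WRow.not_hullCell_frey37569208117_thirty_band (k : ℕ) (h1 : 240 ≤ k) (h2 : k ≤ 407) :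
    ¬ HullCell ((30 * (2 * k + 1) : ℕ) : ℤ) ((330 : ℕ) : ℤ) (((k - 1 : ℕ) : ℤ) + 1) ((30 * (2 * k + 1) / (7 - 1) + 1 : ℕ) : ℤ)
      (((7 : ℕ) : ℤ) ^ 5 - ((5 : ℕ) : ℤ) * ((30 * (2 * k + 1) : ℕ) : ℤ)) := by
  have hq : 30 * (2 * k + 1) / (7 - 1) = 10 * k + 5 := by omega
  have hk : (((k - 1 : ℕ) : ℤ) + 1) = (k : ℤ) := by rw [Nat.cast_sub (by omega : 1 ≤ k)]; push_cast; ring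
  rw [hq, hk]
  refine not_hullCell_of_le (by positivity) ?_
  have hk0 : (240 : ℤ) ≤ (k : ℤ) := by exact_mod_cast h1
  have hk1 : (k : ℤ) ≤ 407 := by exact_mod_cast h2
  push_cast
  nlinarith [mul_nonneg (sub_nonneg.2 hk0) (sub_nonneg.2 hk1)]

/-! ## §2. The untwisted sub-class `e(·|7) ∣ 15·l`: S_H REFUTED at every prime `139 ≤ l ≤ 1655` -/

/-- **HALF (A) AS A BAND: `7¹¹·19 + 5¹²·1019·7151² = 2²⁸·3¹²·11³·67`, every prime `139 ≤ l ≤ 1655`, data with NO twist factor at `7`.** For every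
genuine Θ-volume datum `T` at `(ratPoint (7¹¹·19/c), l)` whose places over `7` have `e(K_x/ℚ₇) ∣ 15·l` (equivalently `= 15·l`) and every pair of
realising Θ- and q-ideles: `¬ Thm311ToCor312.Licence (settingPrVolSharp (pilotDataOfK T.D T.K) …)` — this seat's `WRow.not_licence_triple_of_not_hullCell`
at `(p, e₀, P, i) = (7, 15l, 165, l⋆ − 1)`, turning point `4` (`l ≤ 959`) / `5` (`l ≥ 961`), certificates of §1.
[cite: Mochizuki2012, IUTchI Ex. 3.2 (iv) p. 71; IUTchIII Cor. 3.12 Step (xi-f) p. 184; IUTchIV Prop. 1.1 p. 9, Prop. 1.2 (i)(ii) p. 10, Cor. 2.2 (ii) proof (P5) p. 46]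
[cite: DupuyHilado2025, §3.4, §4.9, §4.12] [claim: Mochizuki2012, status: disputed] -/
theorem WRow.not_licence_frey37569208117_gap_of_fifteen {l : ℕ} (hl : l.Prime) (hlo : 139 ≤ l) (hhi : l ≤ 1655)
    (T : Cor22.ThetaVolumeDatumAt (ratPoint (((7 ^ 11 * 19 : ℕ) : ℚ) / (2 ^ 28 * 3 ^ 12 * 11 ^ 3 * 67 : ℕ))) l)
    (hloc : letI := T.instFieldF; letI := T.instNumberFieldF; letI := T.instAlgebraF; letI := T.instFieldK
      letI := T.instNumberFieldK; letI := T.instAlgebraK; letI := T.instFieldFbar; letI := T.instAlgebraFbar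
      letI := T.instAlgebraKFbar; letI := T.instIsElliptic
      haveI : Fact (Nat.Prime 7) := ⟨by norm_num⟩
      ∀ x₀ : (thetaIndex (pilotDataOfK T.D T.K)).Fibre (.inr ⟨7, by norm_num⟩),
        absRamificationIdx 7 (kOf (pilotDataOfK T.D T.K) 7 x₀) ∣ 15 * l) :
    letI := T.instFieldF; letI := T.instNumberFieldF; letI := T.instAlgebraF; letI := T.instFieldK
    letI := T.instNumberFieldK; letI := T.instAlgebraK; letI := T.instFieldFbar; letI := T.instAlgebraFbar
    letI := T.instAlgebraKFbar; letI := T.instIsElliptic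
    ∀ {logv : PadicLogs T.K} (hlog : LogvAnalytic logv) (M : Type) [Field M] [NumberField M]
      (archPk : ∀ (j : (thetaIndex (pilotDataOfK T.D T.K)).Label) (vQ : (thetaIndex (pilotDataOfK T.D T.K)).VQ),
        Set ((logShellsDH (pilotDataOfK T.D T.K) logv).Packet j vQ))
      (archSub : ∀ (j : (thetaIndex (pilotDataOfK T.D T.K)).Label) (v : (thetaIndex (pilotDataOfK T.D T.K)).V),
        Set ((logShellsDH (pilotDataOfK T.D T.K) logv).Packet j ((thetaIndex (pilotDataOfK T.D T.K)).over v)))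
      (Ψ : ℤ → ∀ v : (thetaIndex (pilotDataOfK T.D T.K)).V, v ∈ (thetaIndex (pilotDataOfK T.D T.K)).Vbad →
        Set ((logShellsDH (pilotDataOfK T.D T.K) logv).StarPacket v))
      (act : ℤ → ∀ v : (thetaIndex (pilotDataOfK T.D T.K)).V, v ∈ (thetaIndex (pilotDataOfK T.D T.K)).Vbad →
        (logShellsDH (pilotDataOfK T.D T.K) logv).StarPacket v → Module.End ℚ ((logShellsDH (pilotDataOfK T.D T.K) logv).StarPacket v))
      (Mmod : ℤ → ∀ j : (thetaIndex (pilotDataOfK T.D T.K)).LabelStar, Set ((logShellsDH (pilotDataOfK T.D T.K) logv).GlobalPacket j.1))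
      (region : ℤ → ∀ j : (thetaIndex (pilotDataOfK T.D T.K)).LabelStar, FinDivisor M → ∀ vQ : (thetaIndex (pilotDataOfK T.D T.K)).VQ,
        Set ((logShellsDH (pilotDataOfK T.D T.K) logv).Packet j.1 vQ))
      (n : ℤ) {HT : Type} {LogLink : HT → HT → Type} {IsFull : ∀ {s t : HT}, LogLink s t → Prop}
      (lat : LGPGaussianLogThetaLattice LogLink IsFull)
      {Frd : Type} {IsoF : Frd → Frd → Type} {Ob : Frd → Type} {realify : Frd → Frd} {Strip : Type}
      {IsoS : Strip → Strip → Type} {Mv : ∀ v : (thetaIndex (pilotDataOfK T.D T.K)).V, v ∈ (thetaIndex (pilotDataOfK T.D T.K)).Vbad → Type}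
      [∀ v h, Monoid (Mv v h)]
      (sig : GlobalLGPFrobenioidSignature (thetaIndex (pilotDataOfK T.D T.K)).lstar (thetaIndex (pilotDataOfK T.D T.K)).V
        (· ∈ (thetaIndex (pilotDataOfK T.D T.K)).Vbad) Frd IsoF Ob realify Strip IsoS Mv)
      (split : SplittingMonoids Mv) {ObΔ : Type} {N : ∀ v : (thetaIndex (pilotDataOfK T.D T.K)).V, v ∈ (thetaIndex (pilotDataOfK T.D T.K)).Vbad → Type}
      [∀ v h, Monoid (N v h)] (qData : QPilotData ObΔ N)
      (tq : ∀ (pp : Nat.Primes) (x : (thetaIndex (pilotDataOfK T.D T.K)).Fibre (.inr pp)),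
        haveI : Fact (pp : ℕ).Prime := ⟨pp.2⟩; kOf (pilotDataOfK T.D T.K) pp.1 x)
      (t : ∀ (pp : Nat.Primes) (_ : Fin (pilotDataOfK T.D T.K).lstar) (x : (thetaIndex (pilotDataOfK T.D T.K)).Fibre (.inr pp)),
        haveI : Fact (pp : ℕ).Prime := ⟨pp.2⟩; kOf (pilotDataOfK T.D T.K) pp.1 x)
      (htq0 : ∀ pp x, tq pp x ≠ 0)
      (htq1 : ∀ (pp : Nat.Primes) (x : (thetaIndex (pilotDataOfK T.D T.K)).Fibre (.inr pp)),
        haveI : Fact (pp : ℕ).Prime := ⟨pp.2⟩; placeOf (pilotDataOfK T.D T.K) pp.1 x ∉ (pilotDataOfK T.D T.K).S → ‖tq pp x‖ = 1)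
      (_ht0 : ∀ pp i x, t pp i x ≠ 0)
      (_ht : ∀ (pp : Nat.Primes) (i : Fin (pilotDataOfK T.D T.K).lstar) (x : (thetaIndex (pilotDataOfK T.D T.K)).Fibre (.inr pp)),
        haveI : Fact (pp : ℕ).Prime := ⟨pp.2⟩
        Real.log ‖t pp i x‖ = -((pilotDataOfK T.D T.K).thetaPilot i (placeOf (pilotDataOfK T.D T.K) pp.1 x)) *
          logNorm T.K (placeOf (pilotDataOfK T.D T.K) pp.1 x) / localDegree T.K (placeOf (pilotDataOfK T.D T.K) pp.1 x))
      (_htq : ∀ (pp : Nat.Primes) (x : (thetaIndex (pilotDataOfK T.D T.K)).Fibre (.inr pp)),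
        haveI : Fact (pp : ℕ).Prime := ⟨pp.2⟩
        Real.log ‖tq pp x‖ = -((pilotDataOfK T.D T.K).qPilot (placeOf (pilotDataOfK T.D T.K) pp.1 x)) *
          logNorm T.K (placeOf (pilotDataOfK T.D T.K) pp.1 x) / localDegree T.K (placeOf (pilotDataOfK T.D T.K) pp.1 x)),
      ¬ Thm311ToCor312.Licence
        (settingPrVolSharp (pilotDataOfK T.D T.K) hlog M archPk archSub Ψ act Mmod region n lat sig split qData tq t htq0 htq1) := by
  letI := T.instFieldF; letI := T.instNumberFieldF; letI := T.instAlgebraF; letI := T.instFieldK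
  letI := T.instNumberFieldK; letI := T.instAlgebraK; letI := T.instFieldFbar; letI := T.instAlgebraFbar
  letI := T.instAlgebraKFbar; letI := T.instIsElliptic
  intro logv hlog M _ _ archPk archSub Ψ act Mmod region n HT LogLink IsFull lat Frd IsoF Ob realify Strip
    IsoS Mv _ sig split ObΔ N _ qData tq t htq0 htq1 ht0 ht htq
  have hp7 : Nat.Prime 7 := by norm_num
  obtain ⟨k, hk⟩ := hl.odd_of_ne_two (by omega)
  have hloc' : letI := T.instFieldF; letI := T.instNumberFieldF; letI := T.instAlgebraF; letI := T.instFieldK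
      letI := T.instNumberFieldK; letI := T.instAlgebraK; letI := T.instFieldFbar; letI := T.instAlgebraFbar
      letI := T.instAlgebraKFbar; letI := T.instIsElliptic
      haveI : Fact (Nat.Prime 7) := ⟨hp7⟩
      ∀ x₀ : (thetaIndex (pilotDataOfK T.D T.K)).Fibre (.inr ⟨7, hp7⟩),
        absRamificationIdx 7 (kOf (pilotDataOfK T.D T.K) 7 x₀) = 15 * l := by
    intro x₀
    obtain ⟨h | h, -⟩ := WRow.localType_seven_frey37569208117 hl (by omega) (by omega) T x₀
    · exact h
    · exfalso
      have h2 := hloc x₀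
      rw [h] at h2
      exact absurd (Nat.le_of_dvd (by omega) h2) (by omega)
  subst hk
  have hpe : ¬ ((⟨7, hp7⟩ : Nat.Primes) : ℕ) ∣ 15 * (2 * k + 1) := fun h => by
    rcases (Nat.Prime.dvd_mul hp7).1 h with h | h
    · revert h; decide
    · have := (Nat.prime_dvd_prime_iff_eq hp7 hl).1 h; omega
  rcases Nat.lt_or_ge k 480 with hk4 | hk5
  · exact WRow.not_licence_triple_of_not_hullCell isABCTriple_frey37569208117 T ⟨7, hp7⟩ (by norm_num) (by simp; omega)
      (by show (7 : ℕ) ∣ _; norm_num) (e₀ := 15 * (2 * k + 1)) (P := 165) (i := k - 1) (a₀ := 4)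
      hpe hloc'
      (by rw [WRow.factorization_frey37569208117_seven]; ring) (by omega)
      (fun t ht => by interval_cases t <;> push_cast <;> omega) (by push_cast; omega)
      (WRow.not_hullCell_frey37569208117_fifteen_band4 k (by omega) (by omega)) hlog M archPk archSub Ψ
      act Mmod region n lat sig split qData tq t htq0 htq1 ht0 ht htq
  · exact WRow.not_licence_triple_of_not_hullCell isABCTriple_frey37569208117 T ⟨7, hp7⟩ (by norm_num) (by simp; omega)
      (by show (7 : ℕ) ∣ _; norm_num) (e₀ := 15 * (2 * k + 1)) (P := 165) (i := k - 1) (a₀ := 5)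
      hpe hloc'
      (by rw [WRow.factorization_frey37569208117_seven]; ring) (by omega)
      (fun t ht => by interval_cases t <;> push_cast <;> omega) (by push_cast; omega)
      (WRow.not_hullCell_frey37569208117_fifteen_band5 k hk5 (by omega)) hlog M archPk archSub Ψ
      act Mmod region n lat sig split qData tq t htq0 htq1 ht0 ht htq

/-! ## §3. Every prime `487 ≤ l ≤ 811`: BOTH local types at `7` fail — S_H REFUTED at EVERY genuine datum -/

/-- **THE REFUTED BAND ABOVE THE [LIN] BAND: `7¹¹·19 + 5¹²·1019·7151² = 2²⁸·3¹²·11³·67`, every prime `487 ≤ l ≤ 811`, NO local-type hypothesis.** For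
every genuine Θ-volume datum `T` at `(ratPoint (7¹¹·19/c), l)` and every pair of realising Θ- and q-ideles: `¬ Thm311ToCor312.Licence (settingPrVolSharp
(pilotDataOfK T.D T.K) …)`. The fibre over `7` has ONE local type (abc-iut-W-row-2 / w4-d094's `WRow.absRamificationIdx_kOf_eq_of_finrank_eq_one`,
`d_mod = 1`), which is `15·l` or `30·l` (`WRow.localType_seven_frey37569208117`); the untwisted case is §2, the twisted case is this seat's socket at
`(7, 30l, 330, l⋆ − 1)`, turning point `5`, certificate `WRow.not_hullCell_frey37569208117_thirty_band`.
[cite: Mochizuki2012, IUTchI Ex. 3.2 (iv) p. 71; IUTchIII Cor. 3.12 Step (xi-f) p. 184; IUTchIV Prop. 1.1 p. 9, Prop. 1.2 (i)(ii) p. 10, Cor. 2.2 (ii) proof (P5) p. 46]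
[cite: DupuyHilado2025, §3.4, §4.9, §4.12] [claim: Mochizuki2012, status: disputed] -/
theorem WRow.not_licence_frey37569208117_gap_low {l : ℕ} (hl : l.Prime) (hlo : 487 ≤ l) (hhi : l ≤ 811)
    (T : Cor22.ThetaVolumeDatumAt (ratPoint (((7 ^ 11 * 19 : ℕ) : ℚ) / (2 ^ 28 * 3 ^ 12 * 11 ^ 3 * 67 : ℕ))) l) :
    letI := T.instFieldF; letI := T.instNumberFieldF; letI := T.instAlgebraF; letI := T.instFieldK
    letI := T.instNumberFieldK; letI := T.instAlgebraK; letI := T.instFieldFbar; letI := T.instAlgebraFbar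
    letI := T.instAlgebraKFbar; letI := T.instIsElliptic
    ∀ {logv : PadicLogs T.K} (hlog : LogvAnalytic logv) (M : Type) [Field M] [NumberField M]
      (archPk : ∀ (j : (thetaIndex (pilotDataOfK T.D T.K)).Label) (vQ : (thetaIndex (pilotDataOfK T.D T.K)).VQ),
        Set ((logShellsDH (pilotDataOfK T.D T.K) logv).Packet j vQ))
      (archSub : ∀ (j : (thetaIndex (pilotDataOfK T.D T.K)).Label) (v : (thetaIndex (pilotDataOfK T.D T.K)).V),
        Set ((logShellsDH (pilotDataOfK T.D T.K) logv).Packet j ((thetaIndex (pilotDataOfK T.D T.K)).over v)))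
      (Ψ : ℤ → ∀ v : (thetaIndex (pilotDataOfK T.D T.K)).V, v ∈ (thetaIndex (pilotDataOfK T.D T.K)).Vbad →
        Set ((logShellsDH (pilotDataOfK T.D T.K) logv).StarPacket v))
      (act : ℤ → ∀ v : (thetaIndex (pilotDataOfK T.D T.K)).V, v ∈ (thetaIndex (pilotDataOfK T.D T.K)).Vbad →
        (logShellsDH (pilotDataOfK T.D T.K) logv).StarPacket v → Module.End ℚ ((logShellsDH (pilotDataOfK T.D T.K) logv).StarPacket v))
      (Mmod : ℤ → ∀ j : (thetaIndex (pilotDataOfK T.D T.K)).LabelStar, Set ((logShellsDH (pilotDataOfK T.D T.K) logv).GlobalPacket j.1))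
      (region : ℤ → ∀ j : (thetaIndex (pilotDataOfK T.D T.K)).LabelStar, FinDivisor M → ∀ vQ : (thetaIndex (pilotDataOfK T.D T.K)).VQ,
        Set ((logShellsDH (pilotDataOfK T.D T.K) logv).Packet j.1 vQ))
      (n : ℤ) {HT : Type} {LogLink : HT → HT → Type} {IsFull : ∀ {s t : HT}, LogLink s t → Prop}
      (lat : LGPGaussianLogThetaLattice LogLink IsFull)
      {Frd : Type} {IsoF : Frd → Frd → Type} {Ob : Frd → Type} {realify : Frd → Frd} {Strip : Type}
      {IsoS : Strip → Strip → Type} {Mv : ∀ v : (thetaIndex (pilotDataOfK T.D T.K)).V, v ∈ (thetaIndex (pilotDataOfK T.D T.K)).Vbad → Type}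
      [∀ v h, Monoid (Mv v h)]
      (sig : GlobalLGPFrobenioidSignature (thetaIndex (pilotDataOfK T.D T.K)).lstar (thetaIndex (pilotDataOfK T.D T.K)).V
        (· ∈ (thetaIndex (pilotDataOfK T.D T.K)).Vbad) Frd IsoF Ob realify Strip IsoS Mv)
      (split : SplittingMonoids Mv) {ObΔ : Type} {N : ∀ v : (thetaIndex (pilotDataOfK T.D T.K)).V, v ∈ (thetaIndex (pilotDataOfK T.D T.K)).Vbad → Type}
      [∀ v h, Monoid (N v h)] (qData : QPilotData ObΔ N)
      (tq : ∀ (pp : Nat.Primes) (x : (thetaIndex (pilotDataOfK T.D T.K)).Fibre (.inr pp)),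
        haveI : Fact (pp : ℕ).Prime := ⟨pp.2⟩; kOf (pilotDataOfK T.D T.K) pp.1 x)
      (t : ∀ (pp : Nat.Primes) (_ : Fin (pilotDataOfK T.D T.K).lstar) (x : (thetaIndex (pilotDataOfK T.D T.K)).Fibre (.inr pp)),
        haveI : Fact (pp : ℕ).Prime := ⟨pp.2⟩; kOf (pilotDataOfK T.D T.K) pp.1 x)
      (htq0 : ∀ pp x, tq pp x ≠ 0)
      (htq1 : ∀ (pp : Nat.Primes) (x : (thetaIndex (pilotDataOfK T.D T.K)).Fibre (.inr pp)),
        haveI : Fact (pp : ℕ).Prime := ⟨pp.2⟩; placeOf (pilotDataOfK T.D T.K) pp.1 x ∉ (pilotDataOfK T.D T.K).S → ‖tq pp x‖ = 1)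
      (_ht0 : ∀ pp i x, t pp i x ≠ 0)
      (_ht : ∀ (pp : Nat.Primes) (i : Fin (pilotDataOfK T.D T.K).lstar) (x : (thetaIndex (pilotDataOfK T.D T.K)).Fibre (.inr pp)),
        haveI : Fact (pp : ℕ).Prime := ⟨pp.2⟩
        Real.log ‖t pp i x‖ = -((pilotDataOfK T.D T.K).thetaPilot i (placeOf (pilotDataOfK T.D T.K) pp.1 x)) *
          logNorm T.K (placeOf (pilotDataOfK T.D T.K) pp.1 x) / localDegree T.K (placeOf (pilotDataOfK T.D T.K) pp.1 x))
      (_htq : ∀ (pp : Nat.Primes) (x : (thetaIndex (pilotDataOfK T.D T.K)).Fibre (.inr pp)),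
        haveI : Fact (pp : ℕ).Prime := ⟨pp.2⟩
        Real.log ‖tq pp x‖ = -((pilotDataOfK T.D T.K).qPilot (placeOf (pilotDataOfK T.D T.K) pp.1 x)) *
          logNorm T.K (placeOf (pilotDataOfK T.D T.K) pp.1 x) / localDegree T.K (placeOf (pilotDataOfK T.D T.K) pp.1 x)),
      ¬ Thm311ToCor312.Licence
        (settingPrVolSharp (pilotDataOfK T.D T.K) hlog M archPk archSub Ψ act Mmod region n lat sig split qData tq t htq0 htq1) := by
  letI := T.instFieldF; letI := T.instNumberFieldF; letI := T.instAlgebraF; letI := T.instFieldK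
  letI := T.instNumberFieldK; letI := T.instAlgebraK; letI := T.instFieldFbar; letI := T.instAlgebraFbar
  letI := T.instAlgebraKFbar; letI := T.instIsElliptic
  intro logv hlog M _ _ archPk archSub Ψ act Mmod region n HT LogLink IsFull lat Frd IsoF Ob realify Strip
    IsoS Mv _ sig split ObΔ N _ qData tq t htq0 htq1 ht0 ht htq
  have hp7 : Nat.Prime 7 := by norm_num
  haveI : Fact (Nat.Prime 7) := ⟨hp7⟩
  -- one local type over `7`
  have hFm : Module.finrank ℚ (fieldOfModuli T.E) = 1 := by
    rw [T.finrank_rat_fieldOfModuli_eq_dmod]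
    exact dmod_eq_one_of_degree_le_one (by rw [degree_ratPoint])
  obtain ⟨u, hu⟩ := (thetaIndex (pilotDataOfK T.D T.K)).fibre_nonempty (.inr ⟨7, hp7⟩)
  obtain ⟨h15 | h30, -⟩ := WRow.localType_seven_frey37569208117 hl (by omega) (by omega) T ⟨u, hu⟩
  · -- untwisted: §2
    refine WRow.not_licence_frey37569208117_gap_of_fifteen hl (by omega) (by omega) T (fun x₀ => ?_) hlog M archPk archSub Ψ
      act Mmod region n lat sig split qData tq t htq0 htq1 ht0 ht htq
    rw [WRow.absRamificationIdx_kOf_eq_of_finrank_eq_one T.D hFm ⟨7, hp7⟩ x₀ ⟨u, hu⟩, h15]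
  · -- twisted: the column fails at `e = 30·l` as well
    obtain ⟨k, hk⟩ := hl.odd_of_ne_two (by omega)
    have hloc' : ∀ x₀ : (thetaIndex (pilotDataOfK T.D T.K)).Fibre (.inr ⟨7, hp7⟩),
        absRamificationIdx 7 (kOf (pilotDataOfK T.D T.K) 7 x₀) = 30 * l := fun x₀ => by
      rw [WRow.absRamificationIdx_kOf_eq_of_finrank_eq_one T.D hFm ⟨7, hp7⟩ x₀ ⟨u, hu⟩, h30]
    subst hk
    have hpe : ¬ ((⟨7, hp7⟩ : Nat.Primes) : ℕ) ∣ 30 * (2 * k + 1) := fun h => by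
      rcases (Nat.Prime.dvd_mul hp7).1 h with h | h
      · revert h; decide
      · have := (Nat.prime_dvd_prime_iff_eq hp7 hl).1 h; omega
    exact WRow.not_licence_triple_of_not_hullCell isABCTriple_frey37569208117 T ⟨7, hp7⟩ (by norm_num) (by simp; omega)
      (by show (7 : ℕ) ∣ _; norm_num) (e₀ := 30 * (2 * k + 1)) (P := 330) (i := k - 1) (a₀ := 5)
      hpe hloc'
      (by rw [WRow.factorization_frey37569208117_seven]; ring) (by omega)
      (fun t ht => by interval_cases t <;> push_cast <;> omega) (by push_cast; omega)
      (WRow.not_hullCell_frey37569208117_thirty_band k (by omega) (by omega)) hlog M archPk archSub Ψ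
      act Mmod region n lat sig split qData tq t htq0 htq1 ht0 ht htq

/-- **… in the instance shape of the W-lane refutations** (chosen realising ideles, pinned reading, every free binder): every prime `487 ≤ l ≤ 811`,
EVERY genuine datum over `(ratPoint (7¹¹·19/c), l)` — extends abc-iut-w5-d107's [LIN] band (`15 ≤ l ≤ 480`,
`GenuineK.not_pilotKummerCompatHull_chosen_frey37569208117_band`) by the floor-exact column.
[cite: Mochizuki2012, IUTchIII Cor. 3.12 Step (xi-f) p. 184; IUTchIV Prop. 1.1 p. 9, Prop. 1.2 (i)(ii) p. 10] [claim: Mochizuki2012, status: disputed] -/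
theorem GenuineK.not_pilotKummerCompatHull_chosen_frey37569208117_gap_low {l : ℕ} (hl : l.Prime) (hlo : 487 ≤ l) (hhi : l ≤ 811)
    (T : Cor22.ThetaVolumeDatumAt (ratPoint (((7 ^ 11 * 19 : ℕ) : ℚ) / (2 ^ 28 * 3 ^ 12 * 11 ^ 3 * 67 : ℕ))) l) :
    letI := T.instFieldF; letI := T.instNumberFieldF; letI := T.instAlgebraF; letI := T.instFieldK
    letI := T.instNumberFieldK; letI := T.instAlgebraK; letI := T.instFieldFbar; letI := T.instAlgebraFbar
    letI := T.instAlgebraKFbar; letI := T.instIsElliptic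
    ∀ (M : Type) [Field M] [NumberField M]
      (archPk : ∀ (j : (thetaIndex (pilotDataOfK T.D T.K)).Label) (vQ : (thetaIndex (pilotDataOfK T.D T.K)).VQ),
        Set ((logShellsDH (pilotDataOfK T.D T.K) (analyticLogv T.K)).Packet j vQ))
      (archSub : ∀ (j : (thetaIndex (pilotDataOfK T.D T.K)).Label) (v : (thetaIndex (pilotDataOfK T.D T.K)).V),
        Set ((logShellsDH (pilotDataOfK T.D T.K) (analyticLogv T.K)).Packet j ((thetaIndex (pilotDataOfK T.D T.K)).over v)))
      (Ψ : ℤ → ∀ v : (thetaIndex (pilotDataOfK T.D T.K)).V, v ∈ (thetaIndex (pilotDataOfK T.D T.K)).Vbad →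
        Set ((logShellsDH (pilotDataOfK T.D T.K) (analyticLogv T.K)).StarPacket v))
      (act : ℤ → ∀ v : (thetaIndex (pilotDataOfK T.D T.K)).V, v ∈ (thetaIndex (pilotDataOfK T.D T.K)).Vbad →
        (logShellsDH (pilotDataOfK T.D T.K) (analyticLogv T.K)).StarPacket v →
          Module.End ℚ ((logShellsDH (pilotDataOfK T.D T.K) (analyticLogv T.K)).StarPacket v))
      (Mmod : ℤ → ∀ j : (thetaIndex (pilotDataOfK T.D T.K)).LabelStar,
        Set ((logShellsDH (pilotDataOfK T.D T.K) (analyticLogv T.K)).GlobalPacket j.1))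
      (region : ℤ → ∀ j : (thetaIndex (pilotDataOfK T.D T.K)).LabelStar, FinDivisor M →
        ∀ vQ : (thetaIndex (pilotDataOfK T.D T.K)).VQ, Set ((logShellsDH (pilotDataOfK T.D T.K) (analyticLogv T.K)).Packet j.1 vQ))
      (frobAdm : ℤ → ℤ → ∀ (j : (thetaIndex (pilotDataOfK T.D T.K)).Label) (vQ : (thetaIndex (pilotDataOfK T.D T.K)).VQ),
        Set ((logShellsDH (pilotDataOfK T.D T.K) (analyticLogv T.K)).Packet j vQ) → Prop)
      (frobLogvol : ℤ → ℤ → ∀ (j : (thetaIndex (pilotDataOfK T.D T.K)).Label) (vQ : (thetaIndex (pilotDataOfK T.D T.K)).VQ),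
        Set ((logShellsDH (pilotDataOfK T.D T.K) (analyticLogv T.K)).Packet j vQ) → ℝ)
      (frobΨ : ℤ → ℤ → ∀ v : (thetaIndex (pilotDataOfK T.D T.K)).V, v ∈ (thetaIndex (pilotDataOfK T.D T.K)).Vbad →
        Set ((logShellsDH (pilotDataOfK T.D T.K) (analyticLogv T.K)).StarPacket v))
      (frobMmod : ℤ → ℤ → ∀ j : (thetaIndex (pilotDataOfK T.D T.K)).LabelStar,
        Set ((logShellsDH (pilotDataOfK T.D T.K) (analyticLogv T.K)).GlobalPacket j.1))
      (unitImage : ℤ → ℤ → ℕ → ∀ (j : (thetaIndex (pilotDataOfK T.D T.K)).Label) (vQ : (thetaIndex (pilotDataOfK T.D T.K)).VQ),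
        Set ((logShellsDH (pilotDataOfK T.D T.K) (analyticLogv T.K)).Packet j vQ))
      (ballImage : ℤ → ℤ → ∀ (j : (thetaIndex (pilotDataOfK T.D T.K)).Label) (vQ : (thetaIndex (pilotDataOfK T.D T.K)).VQ),
        Set ((logShellsDH (pilotDataOfK T.D T.K) (analyticLogv T.K)).Packet j vQ))
      (thetaDiv : ℤ → ℤ → LgpDivisor M (thetaIndex (pilotDataOfK T.D T.K)).lstar)
      (n : ℤ) {HT : Type} {LogLink : HT → HT → Type} {IsFull : ∀ {s t : HT}, LogLink s t → Prop}
      (lat : LGPGaussianLogThetaLattice LogLink IsFull)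
      {Frd : Type} {IsoF : Frd → Frd → Type} {Ob : Frd → Type} {realify : Frd → Frd} {Strip : Type}
      {IsoS : Strip → Strip → Type} {Mv : ∀ v : (thetaIndex (pilotDataOfK T.D T.K)).V, v ∈ (thetaIndex (pilotDataOfK T.D T.K)).Vbad → Type}
      [∀ v h, Monoid (Mv v h)]
      (sig : GlobalLGPFrobenioidSignature (thetaIndex (pilotDataOfK T.D T.K)).lstar (thetaIndex (pilotDataOfK T.D T.K)).V
        (· ∈ (thetaIndex (pilotDataOfK T.D T.K)).Vbad) Frd IsoF Ob realify Strip IsoS Mv)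
      (split : SplittingMonoids Mv) {ObΔ : Type}
      {N : ∀ v : (thetaIndex (pilotDataOfK T.D T.K)).V, v ∈ (thetaIndex (pilotDataOfK T.D T.K)).Vbad → Type}
      [∀ v h, Monoid (N v h)] (qData : QPilotData ObΔ N)
      (qK : ∀ v : (thetaIndex (pilotDataOfK T.D T.K)).V, v ∈ (thetaIndex (pilotDataOfK T.D T.K)).Vbad →
        Set ((logShellsDH (pilotDataOfK T.D T.K) (analyticLogv T.K)).StarPacket v)),
    ¬ Cor312Vol.PilotKummerCompatHull
        (LatticeSituation.ofShells (logShellsDH (pilotDataOfK T.D T.K) (analyticLogv T.K)) M archPk archSub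
          (summandPiecesPr (pilotDataOfK T.D T.K) (logvAnalytic_analyticLogv (F := T.K))).Adm
          (summandPiecesPr (pilotDataOfK T.D T.K) (logvAnalytic_analyticLogv (F := T.K))).logvol Ψ act Mmod region frobAdm
          frobLogvol frobΨ frobMmod unitImage ballImage thetaDiv)
        (settingPrVolSharp (pilotDataOfK T.D T.K) (logvAnalytic_analyticLogv (F := T.K)) M archPk archSub Ψ act Mmod region n
          lat sig split qData (exists_realising_qIdeles_pilotDataOfK T.D).choose (exists_realising_thetaIdeles_pilotDataOfK T.D).choose
          (exists_realising_qIdeles_pilotDataOfK T.D).choose_spec.1 (exists_realising_qIdeles_pilotDataOfK T.D).choose_spec.2.1)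
        (fun _ => Cor312.Setting.qRegion
          (settingPrVolSharp (pilotDataOfK T.D T.K) (logvAnalytic_analyticLogv (F := T.K)) M archPk archSub Ψ act Mmod region n
            lat sig split qData (exists_realising_qIdeles_pilotDataOfK T.D).choose (exists_realising_thetaIdeles_pilotDataOfK T.D).choose
            (exists_realising_qIdeles_pilotDataOfK T.D).choose_spec.1 (exists_realising_qIdeles_pilotDataOfK T.D).choose_spec.2.1))
        qK := by
  letI := T.instFieldF; letI := T.instNumberFieldF; letI := T.instAlgebraF; letI := T.instFieldK
  letI := T.instNumberFieldK; letI := T.instAlgebraK; letI := T.instFieldFbar; letI := T.instAlgebraFbar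
  letI := T.instAlgebraKFbar; letI := T.instIsElliptic
  intro M _ _ archPk archSub Ψ act Mmod region frobAdm frobLogvol frobΨ frobMmod
    unitImage ballImage thetaDiv n HT LogLink IsFull lat Frd IsoF Ob realify Strip IsoS Mv _ sig split ObΔ N _ qData qK hSH
  have hL := licence_of_pilotKummerCompatHull (hq := fun _ _ => rfl) (hc := hSH)
  exact WRow.not_licence_frey37569208117_gap_low hl hlo hhi T (logvAnalytic_analyticLogv (F := T.K)) M archPk archSub Ψ act Mmod
    region n lat sig split qData (exists_realising_qIdeles_pilotDataOfK T.D).choose (exists_realising_thetaIdeles_pilotDataOfK T.D).choose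
    (exists_realising_qIdeles_pilotDataOfK T.D).choose_spec.1 (exists_realising_qIdeles_pilotDataOfK T.D).choose_spec.2.1
    (exists_realising_thetaIdeles_pilotDataOfK T.D).choose_spec.1 (exists_realising_thetaIdeles_pilotDataOfK T.D).choose_spec.2.2
    (exists_realising_qIdeles_pilotDataOfK T.D).choose_spec.2.2 hL

end Summit.ABC.IUTFork.Conditional

end
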